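import Summits.ResolutionOfSingularities.ResolutionOfSingularities.Theorems.StallVertexCompanion
import HarnessLib

/-!
# StallVertexCompanion2 — decomp-res node «StallVertexCompanion (lens-5 g29, rev 10 of the node «StallVertex»;
critic row 192 CLEARED +1)», tree file 2/8 of the node

Content from the decomp-res lens-5 g29 node file `HOME/decomp-res-lens-5/g29/StallVertexCompanion.lean` (pin
deaa8fea) with the critic's ten mechanical lint fixes (fixed sha256 245dae5b; HOME =
run/shared/lean/pub/decomp-res); critic CRITIC-LEDGER row 192 CLEARED +1 — provenance, the fix list, critic text and
the lens header in full in part 2 of the node, `StallVertexCompanion`.  Namespace `…Theorems.StallVertex`;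
`--supports stmt-ResolutionOfSingularities-31770`.

The lens header, verbatim (carried here, in part 2, because part 1 is a single long theorem with no room under the
400-line cap):

> # StallVertexCompanion — decomp-res lens-5, generation 29 (rev 10 of the node «StallVertex»)
>
> KAWANOUE–MATSUKI'S COMPANION ON THE POSITIVE SKEW LEAF, in kernel: its BOUNDARY MONOMIAL (the flat law) and its
> TANGENT CONE (the tangent law).  Target of the generation (critic row 188, (P-1)): the positive leaf
> `NoPositiveSkewStalledTailsDeep` of the host item `MaxContactCut.DefectWalksDeep`
> (`GhostDescent.defectWalksDeep_iff_skewLeaves`).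
>
> §1k `stall_ledger` — the `μ̃`-stall ledger COMPLETED for a GENERAL cone: at a `μ̃`-stalled move `(j, b)` of a corner
> state at a point of `Sing`, for every `μ_P`-minimiser `J₀` (level `a₀`, order `d₀`),
> (6) every KEPT young letter (`i ≠ j`, `b_i = 0`) keeps its divisor mass EXACTLY, `μ_{P',D_i} = μ_{P,D_i}`;
> (7) every LOST young letter (`i = j ∨ b_i ≠ 0`) is NON-DEFICIENT for `g_{J₀}`: `μ_{P,D_i} = ord_{u_i}(g_{J₀}) / a₀`;
> (8) the move ATTAINS the universal bound with the divisor-order content: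
> `ord₀(dirForm) + |s| + k = d₀`, `s = (ord_{u_i} g_{J₀})_{young, b_i ≠ 0}`, `k = [j young] ord_{u_j} g_{J₀}`.
>
> §1l THE COMPANION CONE ALGEBRA (letters `σ`, any field): `attained_factor` (A0: in the equality case of the universal
> bound the chart transform of the cone is `u^s · Θ₁` with `translate_b Θ₁` HOMOGENEOUS —
`translate_eq_homogeneousComponent_of_le_ordZero`);
> `cone_of_low_layer` (A3: if the low layer `in_n(dirForm)` is `u^m ρ ℓ^w` on kept letters, the cone is
> `u^{m+s+k·1_j} ρ' (ℓ − (Σ ℓ_i b_i) u_j)^w` — injectivity of the chart transform on forms); `low_layer_of_cone` (A2: the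
> `u_j^E`-layer of a cone `u^{S''+E·1_j} r ℓ^γ` is `u^{S''} r (ℓ♭)^γ`, `ℓ♭ = ℓ|_{u_j := 0}`); `low_layer_of_staysOnNewest`
> (A1′, three letters: if the NEXT move is a chart change `j' ≠ j` with `b'_j = 0` attaining the bound, the low layer is
> `λ u_{j'}^{k'} u_c^{s'_c} (u_c − b'_c u_{j'})^{n−k'−s'_c}` — in the chart `u_{j'}` it is a ONE-LETTER polynomial of full
> multiplicity at `b'_c`).
>
> §2e THE FLAT LAW (walk level, hypothesis-free on every skew stalled tail): from `N` on EVERY young letter of EVERY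
> minimiser is non-deficient (`flat_law`); `companion_level`: `μ̃(t) = (d₀(t) − |B(t)|)/a₀` with
> `B(t) = (ord_{u_i} g_{J₀}(t))_{young}` (`youngExp`) — the companion `c_t = g_{J₀}(t)/u^{B(t)}` of Kawanoue–Matsuki
> (arXiv:1205.4556 Prop. 3, the element `(c_{f,𝕆}·𝕄^{-a}, μ̃·a)`) is a polynomial of order `w = a₀ μ̃ ≥ 1`
(`youngExp_degree_lt`).
>
> §2f THE TANGENT LAW (walk level, hypothesis-free): `TangentAt W t J₀` := the initial form of `g_{J₀}(t)` is
> `r · u^{B(t)} · ℓ^w`, `r ≠ 0`, `w ≥ 1`, `ℓ` a linear form THROUGH THE DIRECTION `b_t[j_t ↦ 1]` of move `t`.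
> T1 `tangentAt_of_tangentAt_succ`: tangency is never regained (tangent at `t+1` ⟹ tangent at `t`, A2 + A3 + the ledger);
> T2 `tangentAt_of_staysOnNewest`: a `StaysOnNewest` move `t+1` forces tangency at `t` (A1′ + A3 + positivity);
> `tangent_law`: on a positive skew stalled tail with `StaysOnNewest` infinitely often EVERY minimiser is tangent at EVERY
> `t ≥ N` (backward induction along the persisting minimiser, `minimiser_succ`).
>
> §4m/§3c CELLS (positive-leaf binders VERBATIM + one hypothesis-free extra binder each).  CLOSED IN KERNEL:
> `NoDeficientPositiveSkewStalledTailsDeep` (some young letter deficient) — EMPTY by the flat law;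
> `NoSecantPositiveSkewStalledTailsDeep` (some minimiser NOT tangent at some `t ≥ N`) — EMPTY by the tangent law.
> LOCATED RESIDUAL, EXACT: `NoTangentPositiveSkewStalledTailsDeep` (binders + the tangent law as a binder),
> `positive_iff_tangentPositive`, `positive_iff_secant_tangent`; node equation
> `defectWalksDeep_iff_tangentPositive_nullFlat : MaxContactCut.DefectWalksDeep ↔ tangent-positive ∧ null-flat` and the
> deciding theorem `closes_tangentPositive_nullFlat` on `MaxContactCut.DefectWalksDeep` BY NAME (via
> `GhostDescent.closes_leaves`).  (The flat cut `positive_iff_flatPositive` / `closes_flatPositive_nullFlat` is kept.)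
>
> PROVED, 0 sorry, no `allowUnsafeReducibility`.  Imports the landed `StallVertexLockClasses`, `PlanarGhostDescent`.

## This file

Continuation 2/8 of `StallVertexCompanion` (same namespace and sections of the node, cut at the tree's 400-line cap;
section variables / opens replayed): `section AlgebraTangent` — carries `attained_factor`, `linear_ne_zero`,
`cone_of_low_layer`, `free_mul`, `free_pow`, `free_monomial`.

[WRITER NOTE (decomp-res writer g12): file split only (tree files ≤ 400 lines) plus the ten critic-ordered lint
fixes listed in `StallVertexCompanion`; namespace, sections, section variables / opens / `set_option maxHeartbeats …
in` lines and every declaration otherwise exactly as in the lens.]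

(Sources: KawanoueMatsuki2012 arXiv:1205.4556 Prop. 3 (the companion (c_{f,𝕆}·𝕄^{-a}, μ̃·a)); Moh1987; Hauser2010
(kangaroo points); HauserPerlega2019 §2; HauserPerlega2024; CossartPiltant2008 §2; CossartJannsenSaito2020 Ch. 8;
Benito–Villamayor (monomial case); Hironaka2005.)
-/

noncomputable section

open MvPolynomial Finset
open Literature.AlgebraicGeometry.Resolution
open Literature.AlgebraicGeometry.Resolution.Hauser2010
open Literature.AlgebraicGeometry.Resolution.HauserPerlega2024
open Literature.Barriers.ResolutionOfSingularities
open Literature.AlgebraicGeometry.Resolution.PointBlowup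
open Summit.ResolutionOfSingularities.ResolutionOfSingularities.Theses
open Summit.ResolutionOfSingularities.ResolutionOfSingularities.Theorems.TightDefectClasses
open Summit.ResolutionOfSingularities.ResolutionOfSingularities.Theorems.ProximityCut
open Summit.ResolutionOfSingularities.ResolutionOfSingularities.Theorems.ExitLaw
open Summit.ResolutionOfSingularities.ResolutionOfSingularities.Theorems.DifferentialShade

namespace Summit.ResolutionOfSingularities.ResolutionOfSingularities.Theorems.StallVertex

section AlgebraTangent

variable {σ : Type*} {K : Type*} [Field K] [Fintype σ] [DecidableEq σ] [DecidableEq K]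

/-! ### §1l (rev 10, generation 29) THE COMPANION CONE ALGEBRA: equality case, backward carry, low layer of a tangent cone -/

/-- **A0 — EQUALITY CASE of the universal bound** (`ordZero_dirForm_add_le`).  When `ord₀ dirForm + |s| + k = d` is
ATTAINED, the chart transform of the initial form factors as `u^s · Θ₁` with `translate b Θ₁` HOMOGENEOUS of degree
`n` (a form keeps full multiplicity at a point only if it is a cone there: `translate_eq_homogeneousComponent_of_le_ordZero`),
and the low layer of the direction form is `(∏ b_i^{s_i}) · translate b Θ₁`. [new] [folklore] -/
theorem attained_factor {d : ℕ} (j : σ) (b : σ → K) {G : MvPolynomial σ K} (hd : ordZero G = d)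
    (s : σ →₀ ℕ) (hsj : s j = 0) (hsb : ∀ i, s i ≠ 0 → b i ≠ 0) (k : ℕ)
    (hG : ∀ e ∈ G.support, s ≤ e ∧ k ≤ e j) {n : ℕ} (hn : ordZero (dirForm d j b G) = n)
    (hatt : n + (s.degree + k) = d) :
    ∃ Θ₁ : MvPolynomial σ K, chartTransform d j (homogeneousComponent d G) = monomial s 1 * Θ₁ ∧
      PointBlowup.translate b Θ₁ = homogeneousComponent n Θ₁ ∧
      homogeneousComponent n (dirForm d j b G) = C (∏ i, b i ^ (s i)) * PointBlowup.translate b Θ₁ := by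
  classical
  have hΦne : homogeneousComponent d G ≠ 0 := homogeneousComponent_ne_zero_of_ordZero_eq hd
  have hdeg : ∀ e ∈ (homogeneousComponent d G).support, e.degree = d :=
    fun e he => degree_eq_of_mem_support_homogeneousComponent he
  set Θ := chartTransform d j (homogeneousComponent d G) with hΘdef
  -- every monomial of `Θ` dominates `s` and has degree `≤ d - k`
  have hΘsupp : ∀ f ∈ Θ.support, s ≤ f ∧ f.degree + k ≤ d := by
    intro f hf
    obtain ⟨e, he, rfl⟩ := exists_of_mem_support_chartTransform hf
    have heG : e ∈ G.support := mem_support_of_mem_support_homogeneousComponent he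
    obtain ⟨hse, hke⟩ := hG e heG
    refine ⟨fun i => ?_, ?_⟩
    · rw [chartExponent_apply]
      by_cases hij : i = j
      · rw [if_pos hij, hij, hsj]; exact Nat.zero_le _
      · rw [if_neg hij]; exact hse i
    · rw [degree_chartExponent, hdeg e he, Nat.sub_self, zero_add]
      have h1 := degree_eq_add_sum_erase j e
      have h2 := hdeg e he
      omega
  have hmod : MvPolynomial.modMonomial Θ s = 0 := by
    ext f
    rw [coeff_zero]
    by_cases h : s ≤ f
    · exact coeff_modMonomial_of_le _ h
    · rw [coeff_modMonomial_of_not_le _ h]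
      by_contra hne
      exact h (hΘsupp f (MvPolynomial.mem_support_iff.mpr hne)).1
  set Θ₁ := MvPolynomial.divMonomial Θ s with hΘ₁def
  have hfac : Θ = monomial s 1 * Θ₁ := by
    have h := divMonomial_add_modMonomial Θ s
    rw [hmod, add_zero] at h
    exact h.symm
  have hΘ₁deg : ∀ f ∈ Θ₁.support, f.degree ≤ n := by
    intro f hf
    have hfΘ : s + f ∈ Θ.support := by
      rw [MvPolynomial.mem_support_iff] at hf ⊢
      rwa [hΘ₁def, coeff_divMonomial] at hf
    have h := (hΘsupp _ hfΘ).2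
    rw [map_add] at h
    omega
  have hunit : ordZero (PointBlowup.translate b (monomial s (1 : K))) = 0 := by
    refine (ordZero_eq_zero_iff _).mpr ?_
    rw [constantCoeff_translate, eval_monomial, one_mul, Finsupp.prod]
    exact Finset.prod_ne_zero_iff.mpr fun i hi => pow_ne_zero _ (hsb i (Finsupp.mem_support_iff.mp hi))
  have h1 : ordZero (dirForm d j b G) = ordZero (PointBlowup.translate b Θ₁) := by
    show ordZero (PointBlowup.translate b Θ) = _
    rw [hfac]
    unfold PointBlowup.translate
    rw [map_mul, ordZero_mul]
    change ordZero (PointBlowup.translate b (monomial s 1)) + ordZero (PointBlowup.translate b Θ₁) = _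
    rw [hunit, zero_add]
    rfl
  have hord : (n : ℕ∞) ≤ ordZero (PointBlowup.translate b Θ₁) := by rw [← h1, hn]
  have hΨ : PointBlowup.translate b Θ₁ = homogeneousComponent n Θ₁ :=
    translate_eq_homogeneousComponent_of_le_ordZero b hΘ₁deg hord
  refine ⟨Θ₁, hfac, hΨ, ?_⟩
  have hdir : dirForm d j b G = PointBlowup.translate b Θ₁ * PointBlowup.translate b (monomial s 1) := by
    show PointBlowup.translate b Θ = _
    rw [hfac]
    unfold PointBlowup.translate
    rw [map_mul, mul_comm]
  have hmul := homogeneousComponent_mul_of_isHomogeneous' (homogeneousComponent_isHomogeneous n Θ₁)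
    (PointBlowup.translate b (monomial s (1 : K))) 0
  rw [add_zero] at hmul
  rw [hdir, hΨ, hmul, homogeneousComponent_zero, ← constantCoeff_eq, WeightedBlowup.translate_monomial, map_mul,
    constantCoeff_C, one_mul, constantCoeff_prod_X_add_C_pow, mul_comm]

omit [DecidableEq K] in
/-- A linear form with a non-zero coefficient is non-zero. [folklore] -/
theorem linear_ne_zero (l : σ → K) (hl : ∃ i, l i ≠ 0) : (∑ i, C (l i) * X i : MvPolynomial σ K) ≠ 0 := by
  obtain ⟨i₁, hi₁⟩ := hl
  intro h0
  have h1 := coeff_single_linear l i₁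
  rw [h0, coeff_zero] at h1
  exact hi₁ h1.symm

set_option maxHeartbeats 1000000 in
/-- **A3 — THE CONE FROM THE LOW LAYER (backward carry through one ATTAINED move).**  If the low layer
`in_n(dirForm)` is `ρ · u^m · L^w` with `m` supported on KEPT letters (`i ≠ j`, `b_i = 0`) and `L = Σ lᵢuᵢ` a non-zero
`u_j`-free linear form, then the initial form of `G` is `ρ' · u^{m + s + k·1_j} · L̂^w` with the REHOMOGENISED form
`L̂ = L − L(b)·u_j` — which vanishes at the direction `b[j ↦ 1]`.  (Inverse of the carry law; uses A0, the inverse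
translation and the injectivity of `chartTransform d j` on degree-`d` forms.) [new] [folklore] -/
theorem cone_of_low_layer {d : ℕ} (j : σ) (b : σ → K) (hbj : b j = 0) {G : MvPolynomial σ K}
    (hd : ordZero G = d) (s : σ →₀ ℕ) (hsj : s j = 0) (hsb : ∀ i, s i ≠ 0 → b i ≠ 0) (k : ℕ)
    (hG : ∀ e ∈ G.support, s ≤ e ∧ k ≤ e j) {n : ℕ} (hn : ordZero (dirForm d j b G) = n)
    (hatt : n + (s.degree + k) = d) (m : σ →₀ ℕ) (hm : ∀ i, m i ≠ 0 → i ≠ j ∧ b i = 0) {ρ : K} (hρ : ρ ≠ 0)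
    (l : σ → K) (hlj : l j = 0) (hl : ∃ i, l i ≠ 0) (w : ℕ)
    (hA : homogeneousComponent n (dirForm d j b G) = monomial m ρ * (∑ i, C (l i) * X i) ^ w) :
    homogeneousComponent d G =
      monomial (m + s + Finsupp.single j k) (ρ * (∏ i, b i ^ (s i))⁻¹) *
        (∑ i, C (Function.update l j (-(∑ i, l i * b i)) i) * X i) ^ w := by
  classical
  obtain ⟨Θ₁, hfac, hΨhom, hlow⟩ := attained_factor j b hd s hsj hsb k hG hn hatt
  have hκ0 : (∏ i, b i ^ (s i)) ≠ 0 := Finset.prod_ne_zero_iff.mpr fun i _ => by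
    by_cases hsi : s i = 0
    · rw [hsi, pow_zero]; exact one_ne_zero
    · exact pow_ne_zero _ (hsb i hsi)
  obtain ⟨κ, hκ⟩ : ∃ κ : K, κ = ∏ i, b i ^ (s i) := ⟨_, rfl⟩
  rw [← hκ] at hlow hκ0 ⊢
  obtain ⟨L, hL⟩ : ∃ L : MvPolynomial σ K, L = ∑ i, C (l i) * X i := ⟨_, rfl⟩
  obtain ⟨β₀, hβ₀⟩ : ∃ β₀ : K, β₀ = ∑ i, l i * b i := ⟨_, rfl⟩
  obtain ⟨Lh, hLh⟩ : ∃ Lh : MvPolynomial σ K, Lh = ∑ i, C (Function.update l j (-β₀) i) * X i := ⟨_, rfl⟩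
  rw [← hL] at hA
  rw [← hβ₀, ← hLh]
  have hLne : L ≠ 0 := by rw [hL]; exact linear_ne_zero l hl
  have hLhom : L.IsHomogeneous 1 := by rw [hL]; exact isHomogeneous_linear _
  -- degree count `|m| + w = n`
  have hmw : m.degree + w = n := by
    have h1 : (monomial m ρ * L ^ w).IsHomogeneous (m.degree + w) :=
      (isHomogeneous_monomial _ rfl).mul (by simpa using hLhom.pow w)
    have h2 : (monomial m ρ * L ^ w).IsHomogeneous n := by rw [← hA]; exact homogeneousComponent_isHomogeneous n _
    exact h1.inj_right h2 (mul_ne_zero (monomial_eq_zero.not.mpr hρ) (pow_ne_zero _ hLne))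
  -- Ψ and Θ₁ explicitly
  have hΨ : PointBlowup.translate b Θ₁ = C κ⁻¹ * (monomial m ρ * L ^ w) := by
    rw [← hA, hlow, ← mul_assoc, ← C_mul, inv_mul_cancel₀ hκ0, C_1, one_mul]
  have hβ' : ∑ i, l i * -b i = -β₀ := by
    rw [hβ₀, ← Finset.sum_neg_distrib]; exact Finset.sum_congr rfl fun i _ => mul_neg _ _
  have hΘ₁ : Θ₁ = C κ⁻¹ * (monomial m ρ * (L - C β₀) ^ w) := by
    rw [← translate_neg_translate b Θ₁, hΨ]
    unfold PointBlowup.translate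
    rw [map_mul, map_mul, map_pow, algHom_C, algebraMap_eq]
    congr 2
    · rw [aeval_monomial, algebraMap_eq, monomial_eq, Finsupp.prod_fintype _ _ (fun i => pow_zero _),
        Finsupp.prod_fintype _ _ (fun i => pow_zero _)]
      congr 1
      refine Finset.prod_congr rfl fun i _ => ?_
      by_cases hmi : m i = 0
      · rw [hmi, pow_zero, pow_zero]
      · beta_reduce
        rw [(hm i hmi).2, neg_zero, C_0, add_zero]
    · congr 1
      rw [hL, map_sum]
      simp only [map_mul, algHom_C, algebraMap_eq, aeval_X]
      rw [show (∑ i, C (l i) * (X i + C (-b i)) : MvPolynomial σ K) = ∑ i, (C (l i) * X i + C (l i * -b i)) from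
        Finset.sum_congr rfl fun i _ => by rw [mul_add, C_mul], Finset.sum_add_distrib, ← map_sum C, hβ', map_neg,
        ← sub_eq_add_neg]
  -- the candidate cone and its chart transform
  have hΘc : chartTransform d j (homogeneousComponent d G) =
      monomial (m + s) (ρ * κ⁻¹) * (L - C β₀) ^ w := by
    rw [hfac, hΘ₁, ← mul_assoc, ← mul_assoc, mul_comm ((monomial s) (1 : K)) (C κ⁻¹), C_mul_monomial, monomial_mul,
      add_comm s m]
    congr 2
    ring
  have hcand_hom : (monomial (m + s + Finsupp.single j k) (ρ * κ⁻¹) * Lh ^ w).IsHomogeneous d := by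
    have hLh1 : Lh.IsHomogeneous 1 := by rw [hLh]; exact isHomogeneous_linear _
    have hmon : (monomial (m + s + Finsupp.single j k) (ρ * κ⁻¹) : MvPolynomial σ K).IsHomogeneous
        (m + s + Finsupp.single j k).degree := isHomogeneous_monomial _ rfl
    have h := hmon.mul (show (Lh ^ w).IsHomogeneous w by simpa using hLh1.pow w)
    rw [map_add, map_add, Finsupp.degree_single] at h
    rwa [show m.degree + s.degree + k + w = d by omega] at h
  have hcand_deg : ∀ e ∈ (monomial (m + s + Finsupp.single j k) (ρ * κ⁻¹) * Lh ^ w).support, e.degree = d := by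
    intro e he
    by_contra hne
    exact (MvPolynomial.mem_support_iff.mp he) (hcand_hom.coeff_eq_zero hne)
  have hcand : chartTransform d j (monomial (m + s + Finsupp.single j k) (ρ * κ⁻¹) * Lh ^ w) =
      monomial (m + s) (ρ * κ⁻¹) * (L - C β₀) ^ w := by
    rw [chartTransform_form_eq_aeval j hcand_deg, map_mul, map_pow]
    congr 1
    · rw [aeval_monomial, algebraMap_eq, monomial_eq, Finsupp.prod_fintype _ _ (fun i => pow_zero _),
        Finsupp.prod_fintype _ _ (fun i => pow_zero _)]
      congr 1
      refine Finset.prod_congr rfl fun i _ => ?_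
      by_cases hij : i = j
      · subst hij
        rw [if_pos rfl, one_pow, Finsupp.add_apply, hsj,
          show m i = 0 from by_contra fun h => (hm i h).1 rfl, zero_add, pow_zero]
      · rw [if_neg hij, Finsupp.add_apply, Finsupp.single_eq_of_ne hij, add_zero]
    · congr 1
      rw [hLh, map_sum]
      simp only [map_mul, algHom_C, algebraMap_eq, aeval_X]
      rw [show (∑ i, C (Function.update l j (-β₀) i) * (if i = j then (1 : MvPolynomial σ K) else X i)) =
          ∑ i, (C (l i) * X i + if i = j then C (-β₀) else 0) from Finset.sum_congr rfl fun i _ => by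
            by_cases hij : i = j
            · subst hij; rw [if_pos rfl, if_pos rfl, Function.update_self, mul_one, hlj, C_0, zero_mul, zero_add]
            · rw [if_neg hij, if_neg hij, Function.update_of_ne hij, add_zero],
        Finset.sum_add_distrib, Finset.sum_ite_eq', if_pos (Finset.mem_univ _), ← hL, map_neg, ← sub_eq_add_neg]
  -- injectivity of the chart transform on degree-`d` forms
  by_contra hne
  have hdiff : homogeneousComponent d G - monomial (m + s + Finsupp.single j k) (ρ * κ⁻¹) * Lh ^ w ≠ 0 :=
    sub_ne_zero.mpr hne
  have hdeg' : ∀ e ∈ (homogeneousComponent d G - monomial (m + s + Finsupp.single j k) (ρ * κ⁻¹) * Lh ^ w).support,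
      d ≤ e.degree := by
    intro e he
    rcases Finset.mem_union.mp (MvPolynomial.support_sub σ _ _ he) with h | h
    · exact (degree_eq_of_mem_support_homogeneousComponent h).ge
    · exact (hcand_deg e h).ge
  apply chartTransform_ne_zero d j hdiff hdeg'
  have hsplit := chartTransform_add d j
    (homogeneousComponent d G - monomial (m + s + Finsupp.single j k) (ρ * κ⁻¹) * Lh ^ w)
    (monomial (m + s + Finsupp.single j k) (ρ * κ⁻¹) * Lh ^ w)
  rw [sub_add_cancel, hΘc, hcand] at hsplit
  exact (add_eq_right.mp hsplit.symm)

/-! #### `u_j`-free polynomials -/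

omit [Fintype σ] [DecidableEq K] in
/-- Products of `u_j`-free polynomials are `u_j`-free. [folklore] -/
theorem free_mul {j : σ} {P Q : MvPolynomial σ K} (hP : ∀ e ∈ P.support, e j = 0)
    (hQ : ∀ e ∈ Q.support, e j = 0) : ∀ e ∈ (P * Q).support, e j = 0 := by
  classical
  intro e he
  by_contra hne
  have hj : j ∈ (P * Q).vars := (mem_vars_iff_mem_support j).mpr ⟨e, he, Finsupp.mem_support_iff.mpr hne⟩
  rcases Finset.mem_union.mp (vars_mul P Q hj) with h | h
  · obtain ⟨e', he', hj'⟩ := (mem_vars_iff_mem_support j).mp h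
    exact (Finsupp.mem_support_iff.mp hj') (hP e' he')
  · obtain ⟨e', he', hj'⟩ := (mem_vars_iff_mem_support j).mp h
    exact (Finsupp.mem_support_iff.mp hj') (hQ e' he')

omit [Fintype σ] [DecidableEq K] in
/-- Powers of a `u_j`-free polynomial are `u_j`-free. [folklore] -/
theorem free_pow {j : σ} {P : MvPolynomial σ K} (hP : ∀ e ∈ P.support, e j = 0) (n : ℕ) :
    ∀ e ∈ (P ^ n).support, e j = 0 := by
  classical
  induction n with
  | zero =>
    intro e he
    rw [pow_zero, ← C_1, MvPolynomial.mem_support_iff, coeff_C] at he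
    split_ifs at he with h0
    · rw [← h0]; rfl
    · exact absurd rfl he
  | succ n ih => rw [pow_succ]; exact free_mul ih hP

omit [Fintype σ] [DecidableEq K] [DecidableEq σ] in
/-- A monomial without `u_j` is `u_j`-free. [folklore] -/
theorem free_monomial {j : σ} {S : σ →₀ ℕ} (hS : S j = 0) (r : K) :
    ∀ e ∈ (monomial S r : MvPolynomial σ K).support, e j = 0 := by
  classical
  intro e he
  rw [Finset.mem_singleton.mp (support_monomial_subset he), hS]

end AlgebraTangent

end Summit.ResolutionOfSingularities.ResolutionOfSingularities.Theorems.StallVertex
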